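import Mathlib.Analysis.MellinTransform
import Mathlib.NumberTheory.Harmonic.ZetaAsymp
import Mathlib.Analysis.PSeries
import Mathlib.MeasureTheory.Function.Floor
import Mathlib.MeasureTheory.Function.LpSeminorm.CompareExp
import Mathlib.MeasureTheory.Function.LpSeminorm.SMul
import Mathlib.MeasureTheory.Function.L2Space
import Mathlib.Analysis.SpecialFunctions.ImproperIntegrals
import Literature.NumberTheory.LFunctions.GeneralizedRH
import Literature.NumberTheory.LFunctions.RHClassicalEquivalents
import Literature.NumberTheory.LFunctions.ZetaFractionalPartIntegral
import HarnessLib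

/-!
# The Nyman–Beurling–Báez-Duarte criterion: Mellin transforms of Beurling functions, the
elementary half (proved), and the deep half (named facts)

This file decomposes the named fact `Literature.NumberTheory.LFunctions.baezDuarte_iff` (rh.S27,
`Literature/NumberTheory/LFunctions/RHClassicalEquivalents.lean`): Báez-Duarte's Theorem 1.1,
"RH holds iff `χ = 𝟙_{(0,1]}` lies in the `L²(0,∞)`-closure of the span of the natural Beurling
functions `ρ_a(x) = {1/(ax)}`, `a ∈ ℕ`".

## Contents

* `beurlingRhoTrunc k` : the truncated Beurling function `𝟙_{(0,1]}(t)·{1/(kt)}` and its Mellin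
  transform: convergence and holomorphy on `0 < re s` (`mellinConvergent_beurlingRhoTrunc`,
  `differentiableAt_mellin_beurlingRhoTrunc`), and the closed form
  `∫_0^1 {1/(kt)} t^{s-1} dt = 1/(k(s-1)) - k^{-s} ζ(s)/s` first for `1 < re s`
  (`mellin_beurlingRhoTrunc_eq_of_one_lt_re`, term-by-term integration) and then for `0 < re s`,
  `s ≠ 1` (`mellin_beurlingRhoTrunc_eq`, analytic continuation with Mathlib's entire
  `riemannZeta₁`); and Titchmarsh's (2.1.5) itself, `∫_0^∞ {1/t} t^{s-1} dt = -ζ(s)/s` for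
  `0 < re s < 1` (`mellin_fract_one_div_eq`). PROVED. (The sibling file
  `ZetaFractionalPartIntegral.lean` proves Titchmarsh (2.1.4) for `fractIntegral s =
  ∫_1^∞ {x}x^{-s-1} dx`; comparing closed forms gives the bridge
  `mellin_beurlingRhoTrunc_one_eq_fractIntegral : mellin (beurlingRhoTrunc 1) s = fractIntegral s`
  for `0 < re s`, `s ≠ 1`.)
* `memLp_two_fract_one_div` : the Beurling functions `{1/(kx)}`, `k ≥ 1`, lie in `L²((0,∞))`. PROVED.
* `riemannHypothesis_of_beurling_closure` : the "if" half of Theorem 1.1 (closure ⇒ RH),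
  PROVED: if `ζ(s₀) = 0` with `1/2 < re s₀ < 1` and `‖χ - f‖₂ < ε` with `f = Σ c_k ρ_k`, then on
  `(1,∞)` one has `f = C/x` with `C = Σ c_k/k`, so `|C| ≤ ε`; pairing `χ - f` with
  `x^{s₀-1} ∈ L²(0,1)` gives `|1/s₀ - C/(s₀-1)| ≤ ε‖x^{s₀-1}‖₂` (Cauchy–Schwarz and the Mellin
  formula above); `ε → 0` forces `1/s₀ = 0`. Zeros with `re s₀ < 1/2` are excluded by the
  functional equation (`Literature.NumberTheory.LFunctions.quasiRiemannHypothesis_one_half_iff_holds`).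
* `baezDuarte_onlyIf` : the deep "only if" half (RH ⇒ closure), NAMED FACT
  [BaezDuarte2003, Thm. 1.1, proof §2.2], together with its two printed inputs
  `baezDuarte_moebiusSum_approx` (Lemma 2.1 = Balazard–Saias, *Notes 1*, Lemme 2) and
  `baezDuarte_zetaRatio_bound` (Lemma 2.2). Not yet discharged: the proof also needs the
  Mellin–Plancherel isometry `L²(0,∞) → L²(re s = 1/2)` (no `L²`-Mellin transform in Mathlib yet)
  and "RH ⇒ Lindelöf" at abscissa `1/2 - ε`.
* `baezDuarte_iff_of_onlyIf` : assembly, `baezDuarte_onlyIf → baezDuarte_iff`.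
* `forall_riemannZeta_ne_zero_iff_quasiRiemannHypothesis` : the zero-free hypothesis of Lemma 2.1
  is `Literature.QuasiRiemannHypothesis α`. PROVED.
* `zeta_isBigO_rpow_of_riemannHypothesis`, `zeta_inv_isBigO_rpow_of_riemannHypothesis`,
  `lindelofHypothesis_of_riemannHypothesis` : Littlewood's conditional bounds `ζ(s), 1/ζ(s) =
  O(t^ε)` for `σ > 1/2` and RH ⇒ LH (Titchmarsh §14.2, (14.2.5)–(14.2.6)), NAMED FACTS — the
  remaining printed inputs of §2.2 ("Lindelöf at abscissa `1/2 - ε`" = (14.2.5) at `1/2 + ε` plus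
  Lemma 2.2; Littlewood's `∑ μ(a)a^{-s} → 1/ζ(s)`, Titchmarsh Thm. 14.25 (A), is subsumed by
  Lemma 2.1).

## References

* L. Báez-Duarte, *A strengthening of the Nyman–Beurling criterion for the Riemann hypothesis*,
  Atti Accad. Naz. Lincei Rend. Lincei (9) Mat. Appl. 14 (2003), 5–11 (arXiv:math/0202141),
  Thm. 1.1, Lemma 2.1, Lemma 2.2, §2.2.
* M. Balazard, E. Saias, *Notes sur la fonction ζ de Riemann, 1*, Adv. Math. 139 (1998),
  310–321, Lemme 2.
* A. Beurling, *A closure problem related to the Riemann zeta-function*, Proc. Nat. Acad. Sci.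
  41 (1955), 312–314.
* E. C. Titchmarsh, *The Theory of the Riemann Zeta-Function*, 2nd ed. (Heath-Brown), OUP 1986,
  §2.1, eq. (2.1.5), p. 14; §14.2, Thm. 14.2 and (14.2.5)–(14.2.6).
-/

noncomputable section

open Complex Filter Asymptotics MeasureTheory Set
open scoped Real Topology

namespace Literature.NumberTheory.LFunctions

/-! ## The truncated Beurling function and its Mellin transform -/

/-- The truncated natural Beurling function `t ↦ 𝟙_{(0,1]}(t) · {1/(k t)}` (`{·}` the fractional
part, `k` a real dilation parameter), as a complex-valued function on `ℝ` vanishing off `(0,1]`.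
For `k = a ∈ ℕ` this is Báez-Duarte's `ρ_a(x) = ρ(1/(ax))` (§1) restricted to `(0,1]`, i.e.
Beurling's `ρ(θ/x)` with `θ = 1/a`. [cite: BaezDuarte2003, §1] -/
def beurlingRhoTrunc (k : ℝ) : ℝ → ℂ :=
  (Ioc (0 : ℝ) 1).indicator fun t ↦ ((Int.fract (1 / (k * t)) : ℝ) : ℂ)

/-- `beurlingRhoTrunc k` is measurable. [folklore] -/
lemma measurable_beurlingRhoTrunc (k : ℝ) : Measurable (beurlingRhoTrunc k) := by
  unfold beurlingRhoTrunc
  refine Measurable.indicator ?_ measurableSet_Ioc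
  exact Complex.measurable_ofReal.comp (measurable_fract.comp (by fun_prop))

/-- `‖beurlingRhoTrunc k t‖ ≤ 1` (a fractional part lies in `[0,1)`). [folklore] -/
lemma norm_beurlingRhoTrunc_le (k t : ℝ) : ‖beurlingRhoTrunc k t‖ ≤ 1 := by
  unfold beurlingRhoTrunc
  refine (norm_indicator_le_norm_self _ _).trans ?_
  rw [Complex.norm_real, Real.norm_eq_abs, abs_of_nonneg (Int.fract_nonneg _)]
  exact (Int.fract_lt_one _).le

/-- `beurlingRhoTrunc k` vanishes on `(1, ∞)`. [folklore] -/
lemma beurlingRhoTrunc_eq_zero_of_one_lt (k : ℝ) {t : ℝ} (ht : 1 < t) :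
    beurlingRhoTrunc k t = 0 :=
  indicator_of_notMem (fun h ↦ absurd h.2 (not_le.2 ht)) _

/-- `beurlingRhoTrunc k` is integrable (bounded by `1`, supported in `(0,1]`). [folklore] -/
lemma integrable_beurlingRhoTrunc (k : ℝ) : Integrable (beurlingRhoTrunc k) := by
  have : beurlingRhoTrunc k =
      (Ioc (0 : ℝ) 1).indicator (beurlingRhoTrunc k) := by
    unfold beurlingRhoTrunc; rw [indicator_indicator, inter_self]
  rw [this, integrable_indicator_iff measurableSet_Ioc]
  refine Measure.integrableOn_of_bounded (M := 1) measure_Ioc_lt_top.ne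
    (measurable_beurlingRhoTrunc k).aestronglyMeasurable ?_
  exact Eventually.of_forall fun t ↦ norm_beurlingRhoTrunc_le k t

/-- The Mellin integral `∫_0^∞ t^{s-1} · beurlingRhoTrunc k t dt` converges absolutely for
`0 < re s` (Mathlib `mellinConvergent_of_isBigO_rpow`: the function is bounded at `0` and
eventually `0` at `∞`). [folklore] -/
lemma mellinConvergent_beurlingRhoTrunc (k : ℝ) {s : ℂ} (hs : 0 < s.re) :
    MellinConvergent (beurlingRhoTrunc k) s := by
  refine mellinConvergent_of_isBigO_rpow (a := s.re + 1) (b := 0)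
    (integrable_beurlingRhoTrunc k).integrableOn.locallyIntegrableOn ?_ (by linarith) ?_
    (by simpa using hs)
  · have h0 : beurlingRhoTrunc k =ᶠ[atTop] 0 := by
      filter_upwards [eventually_gt_atTop 1] with t ht using beurlingRhoTrunc_eq_zero_of_one_lt k ht
    exact (isBigO_zero _ _).congr' h0.symm EventuallyEq.rfl
  · refine IsBigO.of_bound 1 ?_
    filter_upwards [self_mem_nhdsWithin] with t (ht : 0 < t)
    simpa [Real.rpow_zero] using norm_beurlingRhoTrunc_le k t

/-- Mellin transform of the indicator of `(0, c]` (`c > 0`): `∫_0^c t^{s-1} dt = c^s/s` for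
`0 < re s` (dilation of Mathlib's `hasMellin_one_Ioc`). [folklore] -/
lemma hasMellin_indicator_Ioc {c : ℝ} (hc : 0 < c) {s : ℂ} (hs : 0 < s.re) :
    HasMellin ((Ioc (0 : ℝ) c).indicator (fun _ ↦ (1 : ℂ))) s ((c : ℂ) ^ s / s) := by
  have h1 := hasMellin_one_Ioc hs
  have hfun : (Ioc (0 : ℝ) c).indicator (fun _ ↦ (1 : ℂ)) =
      fun t ↦ (Ioc (0 : ℝ) 1).indicator (fun _ ↦ (1 : ℂ)) (c⁻¹ * t) := by
    ext t
    have hiff : c⁻¹ * t ∈ Ioc (0 : ℝ) 1 ↔ t ∈ Ioc (0 : ℝ) c := by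
      rw [mem_Ioc, mem_Ioc, inv_mul_eq_div, div_le_one hc, div_pos_iff_of_pos_right hc]
    by_cases ht : t ∈ Ioc (0 : ℝ) c
    · rw [indicator_of_mem ht, indicator_of_mem (hiff.2 ht)]
    · rw [indicator_of_notMem ht, indicator_of_notMem (hiff.not.2 ht)]
  refine ⟨?_, ?_⟩
  · rw [hfun]; exact (MellinConvergent.comp_mul_left (inv_pos.2 hc)).2 h1.1
  · rw [hfun, mellin_comp_mul_left _ _ (inv_pos.2 hc), h1.2, ofReal_inv,
      inv_cpow _ _ (by rw [arg_ofReal_of_nonneg hc.le]; exact Real.pi_ne_zero.symm), cpow_neg,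
      inv_inv, smul_eq_mul, mul_one_div]

/-- Counting formula: for `t > 0` and `k > 0`, `∑_{m ≥ 1} 𝟙[t ≤ 1/(k m)] = ⌊1/(k t)⌋`.
[folklore] -/
lemma tsum_indicator_Ioc_eq_floor {k t : ℝ} (hk : 0 < k) (ht : 0 < t) :
    ∑' m : ℕ, (Ioc (0 : ℝ) (1 / (k * (m + 1)))).indicator (fun _ ↦ (1 : ℂ)) t =
      (⌊1 / (k * t)⌋₊ : ℂ) := by
  set N := ⌊1 / (k * t)⌋₊ with hN
  have hiff : ∀ m : ℕ, t ∈ Ioc (0 : ℝ) (1 / (k * (m + 1))) ↔ m < N := by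
    intro m
    rw [mem_Ioc, and_iff_right ht, ← Nat.add_one_le_iff, hN, Nat.le_floor_iff (by positivity),
      le_div_iff₀ (by positivity), le_div_iff₀ (by positivity)]
    push_cast
    constructor <;> intro h <;> nlinarith
  have hterm : ∀ m : ℕ, (Ioc (0 : ℝ) (1 / (k * (m + 1)))).indicator (fun _ ↦ (1 : ℂ)) t =
      if m < N then 1 else 0 := by
    intro m
    by_cases hm : m < N
    · rw [if_pos hm, indicator_of_mem ((hiff m).2 hm)]
    · rw [if_neg hm, indicator_of_notMem ((hiff m).not.2 hm)]
  rw [tsum_congr hterm, tsum_eq_sum (s := Finset.range N)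
    (fun m hm ↦ if_neg (fun h ↦ hm (Finset.mem_range.2 h)))]
  rw [Finset.sum_congr rfl (fun m hm ↦ if_pos (Finset.mem_range.1 hm))]
  simp

/-- Pointwise decomposition on `t > 0`, for `k ≥ 1`:
`𝟙_{(0,1]}(t)·{1/(kt)} = k⁻¹ · 𝟙_{(0,1]}(t)·t⁻¹ - ⌊1/(kt)⌋` (for `t > 1` both sides vanish since
`kt > 1`). [folklore] -/
lemma beurlingRhoTrunc_eq_sub_floor {k t : ℝ} (hk : 1 ≤ k) (ht : 0 < t) :
    beurlingRhoTrunc k t =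
      (k : ℂ)⁻¹ * (Ioc (0 : ℝ) 1).indicator (fun u : ℝ ↦ (u : ℂ) ^ (-1 : ℂ)) t -
        (⌊1 / (k * t)⌋₊ : ℂ) := by
  have hk0 : 0 < k := by linarith
  by_cases ht1 : t ≤ 1
  · have hmem : t ∈ Ioc (0 : ℝ) 1 := ⟨ht, ht1⟩
    simp only [beurlingRhoTrunc, indicator_of_mem hmem, cpow_neg_one]
    rw [← Int.self_sub_floor, ← natCast_floor_eq_intCast_floor (by positivity)]
    push_cast
    ring
  · rw [not_le] at ht1
    have hfl : ⌊1 / (k * t)⌋₊ = 0 := by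
      rw [Nat.floor_eq_zero, div_lt_one (by positivity)]
      nlinarith
    rw [beurlingRhoTrunc_eq_zero_of_one_lt k ht1, hfl,
      indicator_of_notMem (fun h ↦ absurd h.2 (not_le.2 ht1))]
    simp

/-- **Mellin transform of the truncated Beurling function, absolutely convergent range.** For
`1 ≤ k` and `1 < re s`: `∫_0^1 {1/(kt)} t^{s-1} dt = 1/(k(s-1)) - k^{-s} ζ(s)/s`. Proof: write
`⌊1/(kt)⌋ = ∑_{m≥1} 𝟙_{(0,1/(km)]}(t)`, integrate term by term (`∫_0^c t^{s-1} = c^s/s`,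
justified by `∑_m (km)^{-σ}/σ < ∞`) and use `ζ(s) = ∑ m^{-s}`. This is the dilated form of
Titchmarsh (2.1.3)/(2.1.5). [cite: Titchmarsh1986, §2.1 (2.1.5)] -/
theorem mellin_beurlingRhoTrunc_eq_of_one_lt_re {k : ℝ} (hk : 1 ≤ k) {s : ℂ} (hs : 1 < s.re) :
    mellin (beurlingRhoTrunc k) s =
      1 / (k * (s - 1)) - (k : ℂ) ^ (-s) * riemannZeta s / s := by
  have hk0 : 0 < k := by linarith
  have hs0 : 0 < s.re := by linarith
  have hs1 : s ≠ 0 := fun h ↦ by simp [h] at hs0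
  set c : ℕ → ℝ := fun m ↦ 1 / (k * (m + 1)) with hc
  have hc0 : ∀ m, 0 < c m := fun m ↦ by positivity
  set F : ℕ → ℝ → ℂ := fun m t ↦
    (t : ℂ) ^ (s - 1) • (Ioc (0 : ℝ) (c m)).indicator (fun _ ↦ (1 : ℂ)) t with hF
  have hFm : ∀ m, HasMellin ((Ioc (0 : ℝ) (c m)).indicator (fun _ ↦ (1 : ℂ))) s
      (((c m : ℝ) : ℂ) ^ s / s) := fun m ↦ hasMellin_indicator_Ioc (hc0 m) hs0
  have hFint : ∀ m, Integrable (F m) (volume.restrict (Ioi 0)) := fun m ↦ (hFm m).1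
  -- the `L¹` norms of the pieces
  have hFnorm : ∀ m, ∫ t in Ioi (0 : ℝ), ‖F m t‖ = (c m) ^ s.re / s.re := by
    intro m
    have h1 : ∫ t in Ioi (0 : ℝ), ‖F m t‖ =
        ∫ t in Ioi (0 : ℝ), (Ioc (0 : ℝ) (c m)).indicator (fun u : ℝ ↦ u ^ (s.re - 1)) t := by
      refine setIntegral_congr_fun measurableSet_Ioi fun t (ht : 0 < t) ↦ ?_
      simp only [hF, norm_smul, norm_cpow_eq_rpow_re_of_pos ht, sub_re, one_re,
        norm_indicator_eq_indicator_norm, norm_one]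
      by_cases htm : t ∈ Ioc 0 (c m) <;> simp [htm]
    rw [h1, setIntegral_indicator measurableSet_Ioc, inter_eq_right.2 Ioc_subset_Ioi_self,
      ← intervalIntegral.integral_of_le (hc0 m).le,
      integral_rpow (Or.inl (by linarith : -1 < s.re - 1)), sub_add_cancel,
      Real.zero_rpow hs0.ne', sub_zero]
  have hsum : Summable fun m ↦ ∫ t in Ioi (0 : ℝ), ‖F m t‖ := by
    simp_rw [hFnorm]
    refine Summable.div_const ?_ _
    have : ∀ m : ℕ, (c m) ^ s.re = k ^ (-s.re) * ((m + 1 : ℝ) ^ s.re)⁻¹ := by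
      intro m
      simp only [hc]
      rw [one_div, Real.inv_rpow (by positivity), Real.mul_rpow hk0.le (by positivity),
        Real.rpow_neg hk0.le, mul_inv]
    simp_rw [this]
    refine Summable.mul_left _ ?_
    have h := (summable_nat_add_iff 1).2 (Real.summable_nat_rpow_inv.2 hs)
    exact_mod_cast h
  -- pointwise value of `∑ F m`
  have hFtsum : ∀ t ∈ Ioi (0 : ℝ), (t : ℂ) ^ (s - 1) * (⌊1 / (k * t)⌋₊ : ℂ) = ∑' m, F m t := by
    intro t ht
    simp only [hF, smul_eq_mul]
    rw [tsum_mul_left, tsum_indicator_Ioc_eq_floor hk0 ht]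
  -- interchange of sum and integral
  have hswap : ∑' m, ∫ t in Ioi (0 : ℝ), F m t = ∫ t in Ioi (0 : ℝ), ∑' m, F m t :=
    integral_tsum_of_summable_integral_norm hFint hsum
  -- value of the sum of integrals
  have hval : ∑' m, ∫ t in Ioi (0 : ℝ), F m t = (k : ℂ) ^ (-s) * riemannZeta s / s := by
    have hterm : ∀ m : ℕ, ∫ t in Ioi (0 : ℝ), F m t =
        (k : ℂ) ^ (-s) * (1 / ((m : ℂ) + 1) ^ s) / s := by
      intro m
      have h2 : mellin ((Ioc (0 : ℝ) (c m)).indicator (fun _ ↦ (1 : ℂ))) s = _ := (hFm m).2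
      rw [mellin] at h2
      rw [h2]
      congr 1
      have harg : (((k * (m + 1)) : ℝ) : ℂ).arg ≠ π := by
        rw [arg_ofReal_of_nonneg (by positivity)]; exact Real.pi_ne_zero.symm
      simp only [hc]
      rw [one_div, ofReal_inv, inv_cpow _ _ harg, ofReal_mul,
        mul_cpow_ofReal_nonneg hk0.le (by positivity), cpow_neg, mul_inv]
      push_cast
      ring
    rw [tsum_congr hterm, tsum_div_const, tsum_mul_left,
      ← zeta_eq_tsum_one_div_nat_add_one_cpow hs]
  -- integrability of the two pieces of the decomposition
  set A : ℝ → ℂ := (Ioc (0 : ℝ) 1).indicator (fun u : ℝ ↦ (u : ℂ) ^ (-1 : ℂ)) with hA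
  have hAm : HasMellin A s (1 / (s - 1)) := by
    have := hasMellin_cpow_Ioc (-1) (s := s) (by simp; linarith)
    simpa [hA, sub_eq_add_neg] using this
  have hB : MellinConvergent (beurlingRhoTrunc k) s := mellinConvergent_beurlingRhoTrunc k hs0
  have hA' : Integrable (fun t : ℝ ↦ (t : ℂ) ^ (s - 1) • ((k : ℂ)⁻¹ • A t))
      (volume.restrict (Ioi 0)) := hAm.1.const_smul (k : ℂ)⁻¹
  have hGint : Integrable (fun t : ℝ ↦ (t : ℂ) ^ (s - 1) * (⌊1 / (k * t)⌋₊ : ℂ))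
      (volume.restrict (Ioi 0)) := by
    refine (hA'.sub hB).congr ?_
    filter_upwards [ae_restrict_mem measurableSet_Ioi] with t ht
    simp only [Pi.sub_apply, beurlingRhoTrunc_eq_sub_floor hk ht, smul_eq_mul]
    ring
  -- main computation
  calc mellin (beurlingRhoTrunc k) s
      = ∫ t in Ioi (0 : ℝ), ((t : ℂ) ^ (s - 1) • ((k : ℂ)⁻¹ • A t) -
          (t : ℂ) ^ (s - 1) * (⌊1 / (k * t)⌋₊ : ℂ)) := by
        rw [mellin]
        refine setIntegral_congr_fun measurableSet_Ioi fun t ht ↦ ?_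
        simp only [beurlingRhoTrunc_eq_sub_floor hk ht, smul_eq_mul]
        ring
    _ = (k : ℂ)⁻¹ • mellin A s - ∫ t in Ioi (0 : ℝ), (t : ℂ) ^ (s - 1) * (⌊1 / (k * t)⌋₊ : ℂ) := by
        rw [integral_sub hA' hGint, ← mellin_const_smul]
        rfl
    _ = (k : ℂ)⁻¹ * (1 / (s - 1)) - ∫ t in Ioi (0 : ℝ), ∑' m, F m t := by
        rw [hAm.2, smul_eq_mul, setIntegral_congr_fun measurableSet_Ioi hFtsum]
    _ = 1 / (k * (s - 1)) - (k : ℂ) ^ (-s) * riemannZeta s / s := by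
        have hk1 : (k : ℂ) ≠ 0 := by exact_mod_cast hk0.ne'
        have hs2 : s - 1 ≠ 0 := fun h ↦ by have := congrArg re h; simp at this; linarith
        rw [← hswap, hval]
        field_simp

/-- The Mellin transform `s ↦ ∫_0^1 {1/(kt)} t^{s-1} dt` is holomorphic on `0 < re s`
(Mathlib `mellin_differentiableAt_of_isBigO_rpow`). [folklore] -/
lemma differentiableAt_mellin_beurlingRhoTrunc (k : ℝ) {s : ℂ} (hs : 0 < s.re) :
    DifferentiableAt ℂ (mellin (beurlingRhoTrunc k)) s := by
  refine mellin_differentiableAt_of_isBigO_rpow (a := s.re + 1) (b := 0)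
    (integrable_beurlingRhoTrunc k).integrableOn.locallyIntegrableOn ?_ (by linarith) ?_
    (by simpa using hs)
  · have h0 : beurlingRhoTrunc k =ᶠ[atTop] 0 := by
      filter_upwards [eventually_gt_atTop 1] with t ht using beurlingRhoTrunc_eq_zero_of_one_lt k ht
    exact (isBigO_zero _ _).congr' h0.symm EventuallyEq.rfl
  · refine IsBigO.of_bound 1 ?_
    filter_upwards [self_mem_nhdsWithin] with t (ht : 0 < t)
    simpa [Real.rpow_zero] using norm_beurlingRhoTrunc_le k t

/-- **Mellin transform of the truncated Beurling function** (Titchmarsh (2.1.5),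
`ζ(s) = s∫_0^∞ ([x]-x)x^{-s-1} dx` for `0 < σ < 1`, in Beurling's dilated/truncated form): for
`1 ≤ k`, `0 < re s`, `s ≠ 1`, `∫_0^1 {1/(kt)} t^{s-1} dt = 1/(k(s-1)) - k^{-s} ζ(s)/s`. Obtained
from `mellin_beurlingRhoTrunc_eq_of_one_lt_re` by analytic continuation: both
`s(s-1)·mellin` and `s/k - k^{-s} ζ₁(s)` (`ζ(s) = ζ₁(s)/(s-1)`, Mathlib `riemannZeta₁` entire) are
holomorphic on the right half-plane and agree on `re s > 1`.
[cite: Titchmarsh1986, §2.1 (2.1.5)] -/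
theorem mellin_beurlingRhoTrunc_eq {k : ℝ} (hk : 1 ≤ k) {s : ℂ} (hs : 0 < s.re) (hs1 : s ≠ 1) :
    mellin (beurlingRhoTrunc k) s =
      1 / (k * (s - 1)) - (k : ℂ) ^ (-s) * riemannZeta s / s := by
  have hk0 : 0 < k := by linarith
  have hk1 : (k : ℂ) ≠ 0 := by exact_mod_cast hk0.ne'
  set U : Set ℂ := {z : ℂ | 0 < z.re} with hU
  set f : ℂ → ℂ := fun z ↦ z * (z - 1) * mellin (beurlingRhoTrunc k) z with hf
  set g : ℂ → ℂ := fun z ↦ z / k - (k : ℂ) ^ (-z) * riemannZeta₁ z with hg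
  have hUo : IsOpen U := continuous_re.isOpen_preimage _ isOpen_Ioi
  have hfan : AnalyticOnNhd ℂ f U := by
    refine DifferentiableOn.analyticOnNhd (fun z hz ↦ ?_) hUo
    refine DifferentiableAt.differentiableWithinAt ?_
    exact (differentiableAt_id.mul (differentiableAt_id.sub_const 1)).mul
      (differentiableAt_mellin_beurlingRhoTrunc k hz)
  have hgan : AnalyticOnNhd ℂ g U := by
    refine DifferentiableOn.analyticOnNhd (fun z hz ↦ ?_) hUo
    refine DifferentiableAt.differentiableWithinAt ?_
    refine (differentiableAt_id.div_const _).sub ?_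
    refine DifferentiableAt.mul ?_ (differentiable_riemannZeta₁ z)
    exact differentiableAt_id.neg.const_cpow (Or.inl hk1)
  have hpre : IsPreconnected U := (convex_halfSpace_re_gt 0).isPreconnected
  have h2 : (2 : ℂ) ∈ U := by simp [hU]
  have hfg : f =ᶠ[𝓝 2] g := by
    have : ∀ᶠ z in 𝓝 (2 : ℂ), 1 < z.re :=
      (continuous_re.isOpen_preimage _ isOpen_Ioi).mem_nhds (by simp)
    filter_upwards [this] with z hz
    have hz1 : z ≠ 1 := fun h ↦ by simp [h] at hz
    have hz0 : z ≠ 0 := fun h ↦ by simp [h] at hz; linarith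
    have hz2 : z - 1 ≠ 0 := sub_ne_zero.2 hz1
    simp only [hf, hg, mellin_beurlingRhoTrunc_eq_of_one_lt_re hk hz, riemannZeta_eq_inv_sub_mul hz1]
    field_simp
  have heq := hfan.eqOn_of_preconnected_of_eventuallyEq hgan hpre h2 hfg hs
  simp only [hf, hg] at heq
  have hs0 : s ≠ 0 := fun h ↦ by simp [h] at hs
  have hs2 : s - 1 ≠ 0 := sub_ne_zero.2 hs1
  rw [riemannZeta_eq_inv_sub_mul hs1]
  have : mellin (beurlingRhoTrunc k) s = (s / k - (k : ℂ) ^ (-s) * riemannZeta₁ s) / (s * (s - 1)) := by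
    rw [← heq]; field_simp
  rw [this]
  field_simp


/-! ## The elementary half: closure ⇒ RH -/

/-- `L²` tail computation: `‖x ↦ x⁻¹‖_{L²(1,∞)} = 1` (`∫_1^∞ x^{-2} dx = 1`). [folklore] -/
lemma eLpNorm_inv_Ioi_one :
    eLpNorm (fun x : ℝ ↦ x⁻¹) 2 (volume.restrict (Ioi (1 : ℝ))) = 1 := by
  rw [eLpNorm_eq_lintegral_rpow_enorm_toReal (by norm_num) (by norm_num), ENNReal.toReal_ofNat]
  have h1 : ∫⁻ x in Ioi (1 : ℝ), ‖x⁻¹‖ₑ ^ (2 : ℝ) = ∫⁻ x in Ioi (1 : ℝ), ENNReal.ofReal (x ^ (-2 : ℝ)) := by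
    refine setLIntegral_congr_fun measurableSet_Ioi fun x (hx : 1 < x) ↦ ?_
    have hx0 : 0 < x := by linarith
    rw [Real.enorm_eq_ofReal (inv_nonneg.2 hx0.le), ENNReal.ofReal_rpow_of_nonneg (inv_nonneg.2 hx0.le)
      (by norm_num), Real.inv_rpow hx0.le, ← Real.rpow_neg hx0.le]
  have h2 : ∫⁻ x in Ioi (1 : ℝ), ENNReal.ofReal (x ^ (-2 : ℝ)) = 1 := by
    rw [← ofReal_integral_eq_lintegral_ofReal (integrableOn_Ioi_rpow_of_lt (by norm_num) zero_lt_one),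
      integral_Ioi_rpow_of_lt (by norm_num) zero_lt_one]
    · norm_num
    · filter_upwards [ae_restrict_mem measurableSet_Ioi] with x (hx : 1 < x)
      exact Real.rpow_nonneg (by linarith) _
  rw [h1, h2, ENNReal.one_rpow]

/-- **The elementary ("if") half of the Nyman–Beurling–Báez-Duarte criterion** (Báez-Duarte,
Thm. 1.1: "It is clear that we need not prove the if part"; Beurling 1955 for `L²(0,1)`). If
`χ = 𝟙_{(0,1]}` lies in the `L²((0,∞))`-closure of the real span of `x ↦ {1/(kx)}`, `k ∈ ℕ`, i.e.
for every `ε > 0` some `f = ∑_{k<N} c_k {1/((k+1)x)}` has `‖χ - f‖_{L²(0,∞)} < ε`, then the Riemann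
hypothesis holds. Proof: a zero `s₀` with `1/2 < re s₀ < 1` is impossible, because on `(1,∞)`
`f = C/x` with `C = ∑ c_k/(k+1)` whence `|C| ≤ ‖χ - f‖_{L²(1,∞)} < ε`, while by
`mellin_beurlingRhoTrunc_eq` and `ζ(s₀) = 0`,
`∫_0^1 (χ - f)(x) x^{s₀-1} dx = 1/s₀ - C/(s₀-1)`, of modulus `≤ ε‖x^{s₀-1}‖_{L²(0,1)}` by
Cauchy–Schwarz; letting `ε → 0` gives `1/s₀ = 0`. Zeros with `0 < re s₀ < 1/2` are then excluded by
the functional equation (`Literature.NumberTheory.LFunctions.quasiRiemannHypothesis_one_half_iff_holds`). The hypothesis is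
literally the right-hand side of `Literature.NumberTheory.LFunctions.baezDuarte_iff`. [cite: BaezDuarte2003, Thm. 1.1] -/
theorem riemannHypothesis_of_beurling_closure
    (h : ∀ ε : ℝ, 0 < ε → ∃ (N : ℕ) (c : Fin N → ℝ),
      eLpNorm (fun x : ℝ ↦ (Set.Ioc (0 : ℝ) 1).indicator 1 x -
          ∑ k : Fin N, c k * Int.fract (1 / (((k : ℕ) + 1 : ℝ) * x))) 2
        (volume.restrict (Set.Ioi 0)) < ENNReal.ofReal ε) :
    RiemannHypothesis := by
  refine quasiRiemannHypothesis_one_half_iff_holds.1 fun s hζ hσ hσ1 ↦ ?_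
  set μ0 : Measure ℝ := volume.restrict (Ioi 0) with hμ0
  have hre : 0 < s.re := by linarith
  have hs0 : s ≠ 0 := fun h ↦ by simp [h] at hre
  have hs1 : s ≠ 1 := fun h ↦ by simp [h] at hσ1
  -- the test function `g = 𝟙_{(0,1]} x^{s-1}` and its (finite) `L²` norm `M`
  set g : ℝ → ℂ := (Ioc (0 : ℝ) 1).indicator fun x ↦ (x : ℂ) ^ (s - 1) with hg
  have hgm : AEStronglyMeasurable g μ0 := by
    refine (Measurable.indicator ?_ measurableSet_Ioc).aestronglyMeasurable
    exact Complex.measurable_ofReal.pow_const _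
  have hgL2 : MemLp g 2 μ0 := by
    refine (memLp_two_iff_integrable_sq_norm hgm).2 ?_
    have hI : IntegrableOn (fun x : ℝ ↦ x ^ (2 * (s.re - 1))) (Ioc 0 1) μ0 :=
      (intervalIntegral.intervalIntegrable_rpow' (a := 0) (b := 1) (by linarith)).1.restrict
    refine (hI.integrable_indicator measurableSet_Ioc).congr ?_
    filter_upwards [ae_restrict_mem measurableSet_Ioi] with x (hx : 0 < x)
    by_cases hx1 : x ∈ Ioc (0 : ℝ) 1
    · simp only [hg, indicator_of_mem hx1, norm_cpow_eq_rpow_re_of_pos hx, sub_re, one_re]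
      rw [← Real.rpow_natCast, ← Real.rpow_mul hx.le]
      norm_num [mul_comm]
    · simp [hg, indicator_of_notMem hx1]
  set M : ℝ := (eLpNorm g 2 μ0).toReal with hM
  have hM0 : 0 ≤ M := ENNReal.toReal_nonneg
  -- Key estimate: for every `ε > 0`, `‖1/s‖ ≤ ε (M + ‖1/(s-1)‖)`.
  have key : ∀ ε : ℝ, 0 < ε → ‖(1 : ℂ) / s‖ ≤ ε * (M + ‖(1 : ℂ) / (s - 1)‖) := by
    intro ε hε
    obtain ⟨N, c, hN⟩ := h ε hε
    set D : ℝ → ℝ := fun x ↦ (Ioc (0 : ℝ) 1).indicator 1 x -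
      ∑ k : Fin N, c k * Int.fract (1 / (((k : ℕ) + 1 : ℝ) * x)) with hD
    have hDm : Measurable D := by
      refine (measurable_one.indicator measurableSet_Ioc).sub (Finset.measurable_sum _ fun k _ ↦ ?_)
      exact measurable_const.mul (measurable_fract.comp (by fun_prop))
    set C : ℝ := ∑ k : Fin N, c k / ((k : ℕ) + 1) with hC
    ------------------------------------------------------------------
    -- (i) the tail `x > 1` gives `|C| ≤ ε`
    ------------------------------------------------------------------
    have hDtail : ∀ x : ℝ, 1 < x → D x = -C * x⁻¹ := by
      intro x hx
      have hx0 : 0 < x := by linarith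
      have hxm : x ∉ Ioc (0 : ℝ) 1 := fun h' ↦ absurd h'.2 (not_le.2 hx)
      simp only [hD, indicator_of_notMem hxm, zero_sub, hC, neg_mul, Finset.sum_mul, neg_inj]
      refine Finset.sum_congr rfl fun k _ ↦ ?_
      have hk : (0 : ℝ) < (k : ℕ) + 1 := by positivity
      rw [Int.fract_eq_self.2 ⟨by positivity, ?_⟩]
      · field_simp
      · rw [div_lt_one (by positivity)]; nlinarith
    have hCε : |C| ≤ ε := by
      have h1 : eLpNorm D 2 (volume.restrict (Ioi 1)) < ENNReal.ofReal ε :=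
        (eLpNorm_mono_measure D (Measure.restrict_mono_set _ (Ioi_subset_Ioi zero_le_one))).trans_lt hN
      have h2 : eLpNorm D 2 (volume.restrict (Ioi 1)) =
          eLpNorm ((-C) • fun x : ℝ ↦ x⁻¹) 2 (volume.restrict (Ioi 1)) := by
        refine eLpNorm_congr_ae ?_
        filter_upwards [ae_restrict_mem measurableSet_Ioi] with x hx
        rw [hDtail x hx, Pi.smul_apply, smul_eq_mul]
      rw [h2, eLpNorm_const_smul, eLpNorm_inv_Ioi_one, mul_one, enorm_neg,
        Real.enorm_eq_ofReal_abs, ENNReal.ofReal_lt_ofReal_iff hε] at h1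
      exact h1.le
    ------------------------------------------------------------------
    -- (ii) the pairing with `x^{s-1}` on `(0,1]` equals `1/s - C/(s-1)`
    ------------------------------------------------------------------
    set Dc : ℝ → ℂ := (Ioc (0 : ℝ) 1).indicator fun x ↦ (D x : ℂ) with hDc
    have hDcm : Measurable Dc := (Complex.measurable_ofReal.comp hDm).indicator measurableSet_Ioc
    have hDc_eq : ∀ x : ℝ, Dc x = (Ioc (0 : ℝ) 1).indicator (fun _ ↦ (1 : ℂ)) x -
        ∑ k : Fin N, (c k : ℂ) * beurlingRhoTrunc ((k : ℕ) + 1) x := by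
      intro x
      by_cases hx : x ∈ Ioc (0 : ℝ) 1
      · simp only [hDc, hD, beurlingRhoTrunc, indicator_of_mem hx, Pi.one_apply]
        push_cast
        rfl
      · simp only [hDc, beurlingRhoTrunc, indicator_of_notMem hx, mul_zero,
          Finset.sum_const_zero, sub_zero]
    have hmel : ∀ k : Fin N, mellin (beurlingRhoTrunc ((k : ℕ) + 1)) s =
        1 / ((((k : ℕ) : ℂ) + 1) * (s - 1)) := by
      intro k
      have := mellin_beurlingRhoTrunc_eq (k := (k : ℕ) + 1) (by simp) hre hs1
      rw [this, hζ, mul_zero, zero_div, sub_zero]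
      push_cast
      ring
    have hI : ∫ x in Ioi (0 : ℝ), (x : ℂ) ^ (s - 1) • Dc x = 1 / s - C / (s - 1) := by
      have hlin : (fun x : ℝ ↦ (x : ℂ) ^ (s - 1) • Dc x) = fun x : ℝ ↦
          (x : ℂ) ^ (s - 1) • (Ioc (0 : ℝ) 1).indicator (fun _ ↦ (1 : ℂ)) x -
            ∑ k : Fin N, (c k : ℂ) * ((x : ℂ) ^ (s - 1) • beurlingRhoTrunc ((k : ℕ) + 1) x) := by
        funext x
        rw [hDc_eq, smul_eq_mul, smul_eq_mul, mul_sub, Finset.mul_sum]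
        congr 1
        exact Finset.sum_congr rfl fun k _ ↦ by rw [smul_eq_mul]; ring
      have hint1 : Integrable (fun x : ℝ ↦ (x : ℂ) ^ (s - 1) •
          (Ioc (0 : ℝ) 1).indicator (fun _ ↦ (1 : ℂ)) x) μ0 := (hasMellin_one_Ioc hre).1
      have hint2 : ∀ k : Fin N, Integrable (fun x : ℝ ↦ (c k : ℂ) *
          ((x : ℂ) ^ (s - 1) • beurlingRhoTrunc ((k : ℕ) + 1) x)) μ0 :=
        fun k ↦ (mellinConvergent_beurlingRhoTrunc _ hre).const_mul _
      rw [hlin, integral_sub hint1 (integrable_finsetSum _ fun k _ ↦ hint2 k),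
        integral_finsetSum _ fun k _ ↦ hint2 k]
      have h1 : ∫ x in Ioi (0 : ℝ), (x : ℂ) ^ (s - 1) •
          (Ioc (0 : ℝ) 1).indicator (fun _ ↦ (1 : ℂ)) x = 1 / s := (hasMellin_one_Ioc hre).2
      have h2 : ∀ k : Fin N, ∫ x in Ioi (0 : ℝ), (x : ℂ) ^ (s - 1) •
          beurlingRhoTrunc ((k : ℕ) + 1) x = 1 / ((((k : ℕ) : ℂ) + 1) * (s - 1)) :=
        fun k ↦ hmel k
      rw [h1, Finset.sum_congr rfl fun k _ ↦
        (integral_const_mul _ _).trans (congrArg (fun z ↦ (c k : ℂ) * z) (h2 k))]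
      rw [hC]
      push_cast
      rw [Finset.sum_div]
      congr 1
      refine Finset.sum_congr rfl fun k _ ↦ ?_
      have hk : (((k : ℕ) : ℂ) + 1) ≠ 0 := by exact_mod_cast Nat.succ_ne_zero k
      have hs2 : s - 1 ≠ 0 := sub_ne_zero.2 hs1
      field_simp
    ------------------------------------------------------------------
    -- (iii) Cauchy–Schwarz on `(0,1]`: the pairing has norm `≤ ε M`
    ------------------------------------------------------------------
    have hIle : ‖∫ x in Ioi (0 : ℝ), (x : ℂ) ^ (s - 1) • Dc x‖ ≤ ε * M := by
      have hprod : (fun x : ℝ ↦ (x : ℂ) ^ (s - 1) • Dc x) = Dc • g := by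
        funext x
        simp only [Pi.smul_apply', smul_eq_mul, hDc, hg]
        by_cases hx : x ∈ Ioc (0 : ℝ) 1
        · simp only [indicator_of_mem hx]; ring
        · simp only [indicator_of_notMem hx, mul_zero]
      have hDc2 : eLpNorm Dc 2 μ0 ≤ ENNReal.ofReal ε := by
        refine (eLpNorm_mono fun x ↦ ?_).trans hN.le
        simp only [hDc]
        refine (norm_indicator_le_norm_self _ _).trans ?_
        rw [Complex.norm_real]
      have hH : eLpNorm (Dc • g) 1 μ0 ≤ ENNReal.ofReal ε * eLpNorm g 2 μ0 :=
        (eLpNorm_smul_le_mul_eLpNorm hgm hDcm.aestronglyMeasurable).trans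
          (by gcongr)
      have hfin : ENNReal.ofReal ε * eLpNorm g 2 μ0 ≠ ⊤ :=
        ENNReal.mul_ne_top ENNReal.ofReal_ne_top hgL2.eLpNorm_lt_top.ne
      calc ‖∫ x in Ioi (0 : ℝ), (x : ℂ) ^ (s - 1) • Dc x‖
          ≤ (∫⁻ x in Ioi (0 : ℝ), ENNReal.ofReal ‖(x : ℂ) ^ (s - 1) • Dc x‖).toReal :=
            norm_integral_le_lintegral_norm _
        _ = (eLpNorm (Dc • g) 1 μ0).toReal := by
            rw [← hprod, eLpNorm_one_eq_lintegral_enorm]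
            simp_rw [ofReal_norm]
            rfl
        _ ≤ (ENNReal.ofReal ε * eLpNorm g 2 μ0).toReal := ENNReal.toReal_mono hfin hH
        _ = ε * M := by rw [ENNReal.toReal_mul, ENNReal.toReal_ofReal hε.le]
    ------------------------------------------------------------------
    -- combine
    ------------------------------------------------------------------
    have hCn : ‖(C : ℂ) / (s - 1)‖ ≤ ε * ‖(1 : ℂ) / (s - 1)‖ := by
      rw [norm_div, norm_div, norm_one, Complex.norm_real, Real.norm_eq_abs, ← div_eq_mul_one_div]
      exact div_le_div_of_nonneg_right hCε (norm_nonneg _)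
    calc ‖(1 : ℂ) / s‖ = ‖(1 / s - C / (s - 1)) + C / (s - 1)‖ := by rw [sub_add_cancel]
      _ ≤ ‖1 / s - C / (s - 1)‖ + ‖(C : ℂ) / (s - 1)‖ := norm_add_le _ _
      _ ≤ ε * M + ε * ‖(1 : ℂ) / (s - 1)‖ := add_le_add (hI ▸ hIle) hCn
      _ = ε * (M + ‖(1 : ℂ) / (s - 1)‖) := by ring
  -- Conclusion: `‖1/s‖ = 0`, absurd.
  have hpos : 0 < ‖(1 : ℂ) / s‖ := norm_pos_iff.2 (one_div_ne_zero hs0)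
  set K : ℝ := M + ‖(1 : ℂ) / (s - 1)‖ with hK
  have hK0 : 0 ≤ K := by positivity
  have := key (‖(1 : ℂ) / s‖ / (2 * (K + 1))) (by positivity)
  have hlt : ‖(1 : ℂ) / s‖ / (2 * (K + 1)) * K < ‖(1 : ℂ) / s‖ := by
    rw [div_mul_eq_mul_div, div_lt_iff₀ (by positivity)]
    nlinarith
  linarith

/-! ## The deep half: named facts (Báez-Duarte 2003, §2) -/

/-- **Báez-Duarte's Lemma 2.1 (Balazard–Saias, *Notes 1*, Lemme 2)** NAMED FACT. "Let
`1/2 ≤ α < 1`, `δ > 0`, `ε > 0`. If `ζ(s)` does not vanish in the half-plane `Re(s) > α`, then for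
`n ≥ 2` and `α + δ ≤ Re(s) ≤ 1` we have `∑_{a=1}^n μ(a) a^{-s} = 1/ζ(s) + O_{α,δ,ε}(n^{-δ/3}(1+|τ|)^ε)`"
(`s = σ + iτ`; a quantitative form of Littlewood's theorem, Titchmarsh Thm. 14.25 (A)). Vendored
with the implied constant made explicit and with `s ≠ 1` (at the pole the source reads
`1/ζ(1) = 0`, whereas Mathlib's `riemannZeta 1` is a finite junk value; excluding `s = 1` only
weakens the statement). Users take `(h : baezDuarte_moebiusSum_approx)`.
[cite: BaezDuarte2003, Lemma 2.1] -/
def baezDuarte_moebiusSum_approx : Prop :=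
  ∀ (α δ ε : ℝ), 1 / 2 ≤ α → α < 1 → 0 < δ → 0 < ε →
    (∀ s : ℂ, α < s.re → riemannZeta s ≠ 0) →
    ∃ C : ℝ, ∀ (n : ℕ) (s : ℂ), 2 ≤ n → α + δ ≤ s.re → s.re ≤ 1 → s ≠ 1 →
      ‖(∑ a ∈ Finset.Icc 1 n, (ArithmeticFunction.moebius a : ℂ) / (a : ℂ) ^ s) -
          1 / riemannZeta s‖ ≤ C * (n : ℝ) ^ (-δ / 3) * (1 + |s.im|) ^ ε

/-- **Báez-Duarte's Lemma 2.2** NAMED FACT (unconditional; functional equation plus Stirling's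
formula for `Γ` in vertical strips, Rademacher (21.51)–(21.52)): "For `0 ≤ ε ≤ ε₀ < 1/4` there is
a positive constant `C = C(ε₀)` such that for all `τ`,
`|ζ(1/2 - ε + iτ)/ζ(1/2 + ε + iτ)| ≤ C(1+|τ|)^ε`." (The sequel paper "…, 2", arXiv:math/0205003, states its Lemma 2.2
with `ε₀ < 1/2`; we vendor the `ε₀ < 1/4` range of arXiv:math/0202141, implied by both.) At a
common zero of numerator and denominator the quotient is read in Lean as `0`, which only weakens
the statement. Users take `(h : baezDuarte_zetaRatio_bound)`. [cite: BaezDuarte2003, Lemma 2.2] -/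
def baezDuarte_zetaRatio_bound : Prop :=
  ∀ ε₀ : ℝ, 0 ≤ ε₀ → ε₀ < 1 / 4 → ∃ C : ℝ, 0 < C ∧
    ∀ (ε τ : ℝ), 0 ≤ ε → ε ≤ ε₀ →
      ‖riemannZeta (1 / 2 - ε + τ * I) / riemannZeta (1 / 2 + ε + τ * I)‖ ≤ C * (1 + |τ|) ^ ε

/-- **The deep ("only if") half of the Nyman–Beurling–Báez-Duarte criterion** NAMED FACT
(Báez-Duarte, Thm. 1.1, proof in §2.2): under RH, `χ = 𝟙_{(0,1]}` lies in the
`L²((0,∞))`-closure of the span of the natural Beurling functions `x ↦ {1/(kx)}`, `k ∈ ℕ`; in the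
spelled-out form of `Literature.NumberTheory.LFunctions.baezDuarte_iff` (real coefficients suffice, all functions being
real-valued). Printed proof: with `f_{ε,n} = ∑_{a≤n} μ(a)a^{-ε}ρ_a ∈ B_nat`, the Mellin–Plancherel
isometry `M : L²(0,∞) → L²(re s = 1/2)` and `M(ρ_a)(s) = -a^{-s}ζ(s)/s` (Titchmarsh (2.1.5), cf.
`mellin_beurlingRhoTrunc_eq`) give
`M(x^{-ε}f_{2ε,n})(τ) = -ζ(1/2-ε+iτ)/(1/2-ε+iτ) · ∑_{a≤n} μ(a)a^{-1/2-ε-iτ}`; Lemma 2.1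
(`baezDuarte_moebiusSum_approx`, needs RH), Lemma 2.2 (`baezDuarte_zetaRatio_bound`) and
RH ⇒ Lindelöf at abscissa `1/2-ε` give an `L²` majorant `K_ε(1+|τ|)^{-1+2ε}`, so
`f_{ε,n} → f_ε` in `L²(0,∞)` (dominated convergence), i.e. `f_ε ∈ closure(B_nat)`; Lemma 2.2 again
gives `f_ε → -χ` in `L²` as `ε ↓ 0`. Not yet discharged (no `L²`-Mellin–Plancherel theorem in
Mathlib). Users take `(h : baezDuarte_onlyIf)`; see `baezDuarte_iff_of_onlyIf`.
[cite: BaezDuarte2003, Thm. 1.1 and §2.2] -/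
def baezDuarte_onlyIf : Prop :=
  RiemannHypothesis →
    ∀ ε : ℝ, 0 < ε → ∃ (N : ℕ) (c : Fin N → ℝ),
      eLpNorm (fun x : ℝ ↦ (Set.Ioc (0 : ℝ) 1).indicator 1 x -
          ∑ k : Fin N, c k * Int.fract (1 / (((k : ℕ) + 1 : ℝ) * x))) 2
        (volume.restrict (Set.Ioi 0)) < ENNReal.ofReal ε

/-- **Assembly.** Báez-Duarte's Theorem 1.1 (`Literature.NumberTheory.LFunctions.baezDuarte_iff`) follows from its deep half
`baezDuarte_onlyIf` (named fact) and the elementary half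
`riemannHypothesis_of_beurling_closure` (proved above). [cite: BaezDuarte2003, Thm. 1.1] -/
theorem baezDuarte_iff_of_onlyIf (h : baezDuarte_onlyIf) : baezDuarte_iff :=
  ⟨h, riemannHypothesis_of_beurling_closure⟩

/-! ## Complements: Titchmarsh (2.1.5) proper, `L²`-membership of the Beurling functions,
the zero-free hypothesis of Lemma 2.1, and Littlewood's conditional bounds (Titchmarsh §14.2) -/

/-- **Titchmarsh's (2.1.5)**, `ζ(s) = s ∫_0^∞ ([x]-x) x^{-s-1} dx` for `0 < σ < 1`, in Mellin form
after `x ↦ 1/x` (the "well-known identity at the root of the Nyman–Beurling formulation" of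
Báez-Duarte §2.2): `∫_0^∞ {1/t} t^{s-1} dt = -ζ(s)/s` for `0 < re s < 1`. From
`mellin_beurlingRhoTrunc_eq` (`k = 1`) plus the tail `∫_1^∞ t^{s-2} dt = 1/(1-s)`, on which
`{1/t} = 1/t`. [cite: Titchmarsh1986, §2.1 (2.1.5)] -/
theorem mellin_fract_one_div_eq {s : ℂ} (hs0 : 0 < s.re) (hs1 : s.re < 1) :
    mellin (fun t : ℝ ↦ ((Int.fract (1 / t) : ℝ) : ℂ)) s = -riemannZeta s / s := by
  have hs2 : s ≠ 1 := fun h ↦ by simp [h] at hs1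
  have hs3 : s - 1 ≠ 0 := sub_ne_zero.2 hs2
  have hsplit : ∀ t ∈ Ioi (0 : ℝ), (t : ℂ) ^ (s - 1) • (((Int.fract (1 / t) : ℝ) : ℂ)) =
      (t : ℂ) ^ (s - 1) • beurlingRhoTrunc 1 t +
        (Ioi (1 : ℝ)).indicator (fun u : ℝ ↦ (u : ℂ) ^ (s - 2)) t := by
    intro t ht
    have ht0 : (0 : ℝ) < t := ht
    by_cases ht1 : t ≤ 1
    · have hmem : t ∈ Ioc (0 : ℝ) 1 := ⟨ht0, ht1⟩
      simp only [beurlingRhoTrunc, indicator_of_mem hmem, one_mul,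
        indicator_of_notMem (fun h : t ∈ Ioi (1 : ℝ) ↦ absurd ht1 (not_le.2 h)), add_zero]
    · rw [not_le] at ht1
      have hfr : Int.fract (1 / t) = 1 / t := by
        rw [Int.fract_eq_self]
        exact ⟨by positivity, by rw [div_lt_one ht0]; exact ht1⟩
      have ht2 : (t : ℂ) ≠ 0 := by exact_mod_cast ht0.ne'
      rw [beurlingRhoTrunc_eq_zero_of_one_lt 1 ht1, smul_zero, zero_add,
        indicator_of_mem (show t ∈ Ioi (1 : ℝ) from ht1), hfr, smul_eq_mul,
        show s - 2 = (s - 1) + (-1) by ring, cpow_add _ _ ht2, cpow_neg_one]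
      push_cast
      ring
  have hint2 : Integrable ((Ioi (1 : ℝ)).indicator (fun u : ℝ ↦ (u : ℂ) ^ (s - 2)))
      (volume.restrict (Ioi 0)) :=
    ((integrableOn_Ioi_cpow_of_lt (by simp; linarith) zero_lt_one).integrable_indicator
      measurableSet_Ioi).restrict
  rw [mellin, setIntegral_congr_fun measurableSet_Ioi hsplit,
    integral_add (mellinConvergent_beurlingRhoTrunc 1 hs0) hint2]
  have h1 : ∫ t in Ioi (0 : ℝ), (t : ℂ) ^ (s - 1) • beurlingRhoTrunc 1 t =
      1 / (s - 1) - riemannZeta s / s := by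
    have := mellin_beurlingRhoTrunc_eq (k := 1) le_rfl hs0 hs2
    rw [mellin] at this
    rw [this]; push_cast; simp
  have h2 : ∫ t in Ioi (0 : ℝ), (Ioi (1 : ℝ)).indicator (fun u : ℝ ↦ (u : ℂ) ^ (s - 2)) t =
      -(1 / (s - 1)) := by
    rw [setIntegral_indicator measurableSet_Ioi, Ioi_inter_Ioi]
    norm_num
    rw [integral_Ioi_cpow_of_lt (by simp; linarith) zero_lt_one]
    push_cast
    rw [one_cpow, show s - 2 + 1 = s - 1 by ring]
    ring
  rw [h1, h2]
  ring

/-- Bridge to `ZetaFractionalPartIntegral.lean`: for `0 < re s`, `s ≠ 1`, the Mellin transform of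
the truncated Beurling function `𝟙_{(0,1]}(t)·{1/t}` *is* Titchmarsh's fractional-part integral
`fractIntegral s = ∫_1^∞ {x} x^{-s-1} dx` (substitute `x = 1/t`); obtained here by comparing the
closed forms `mellin_beurlingRhoTrunc_eq` (`k = 1`) and `riemannZeta_eq_of_re_pos`
(Titchmarsh (2.1.4)). [cite: Titchmarsh1986, §2.1 eq. (2.1.4)] -/
theorem mellin_beurlingRhoTrunc_one_eq_fractIntegral {s : ℂ} (hs : 0 < s.re) (hs1 : s ≠ 1) :
    mellin (beurlingRhoTrunc 1) s = fractIntegral s := by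
  have h1 := mellin_beurlingRhoTrunc_eq (k := 1) le_rfl hs hs1
  have h2 := riemannZeta_eq_of_re_pos hs hs1
  have hs0 : s ≠ 0 := fun h ↦ by simp [h] at hs
  have hs1' : s - 1 ≠ 0 := sub_ne_zero.2 hs1
  rw [h1, h2]
  push_cast
  rw [one_cpow]
  field_simp
  ring

/-- The natural Beurling functions `x ↦ {1/(kx)}` (`k ≥ 1`) lie in `L²((0,∞))`: they are bounded by
`min(1, 1/x)`. [folklore] -/
lemma memLp_two_fract_one_div {k : ℝ} (hk : 1 ≤ k) :
    MemLp (fun x : ℝ ↦ Int.fract (1 / (k * x))) 2 (volume.restrict (Ioi (0 : ℝ))) := by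
  have hk0 : 0 < k := by linarith
  set g : ℝ → ℝ := fun x ↦ (Ioc (0 : ℝ) 1).indicator (fun _ ↦ (1 : ℝ)) x +
    (Ioi (1 : ℝ)).indicator (fun x ↦ x⁻¹) x with hg
  have hg1 : MemLp ((Ioc (0 : ℝ) 1).indicator fun _ ↦ (1 : ℝ)) 2 (volume.restrict (Ioi (0 : ℝ))) :=
    memLp_indicator_const 2 measurableSet_Ioc 1 (Or.inr (by
      rw [Measure.restrict_apply measurableSet_Ioc]; exact (measure_mono inter_subset_left).trans_lt measure_Ioc_lt_top |>.ne))
  have hg2 : MemLp ((Ioi (1 : ℝ)).indicator fun x : ℝ ↦ x⁻¹) 2 (volume.restrict (Ioi (0 : ℝ))) := by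
    rw [memLp_indicator_iff_restrict measurableSet_Ioi, Measure.restrict_restrict measurableSet_Ioi,
      Ioi_inter_Ioi, show max (1 : ℝ) 0 = 1 by norm_num]
    refine ⟨by fun_prop, ?_⟩
    rw [eLpNorm_inv_Ioi_one]
    exact ENNReal.one_lt_top
  have hgL2 : MemLp g 2 (volume.restrict (Ioi (0 : ℝ))) := hg1.add hg2
  refine hgL2.mono' ?_ ?_
  · exact (measurable_fract.comp (by fun_prop)).aestronglyMeasurable
  · filter_upwards [ae_restrict_mem measurableSet_Ioi] with x (hx : 0 < x)
    have h0 : 0 ≤ Int.fract (1 / (k * x)) := Int.fract_nonneg _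
    rw [Real.norm_eq_abs, abs_of_nonneg h0]
    by_cases hx1 : x ≤ 1
    · have : x ∉ Ioi (1 : ℝ) := fun h ↦ absurd hx1 (not_le.2 h)
      simp only [hg, indicator_of_mem (show x ∈ Ioc (0 : ℝ) 1 from ⟨hx, hx1⟩),
        indicator_of_notMem this, add_zero]
      exact (Int.fract_lt_one _).le
    · rw [not_le] at hx1
      have : x ∉ Ioc (0 : ℝ) 1 := fun h ↦ absurd h.2 (not_le.2 hx1)
      simp only [hg, indicator_of_notMem this, indicator_of_mem (show x ∈ Ioi (1 : ℝ) from hx1),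
        zero_add]
      calc Int.fract (1 / (k * x)) ≤ 1 / (k * x) := by
            rw [← Int.self_sub_floor, sub_le_self_iff]
            exact_mod_cast Int.floor_nonneg.2 (by positivity : (0 : ℝ) ≤ 1 / (k * x))
        _ ≤ x⁻¹ := by
          rw [one_div, mul_inv]
          exact mul_le_of_le_one_left (inv_nonneg.2 hx.le) (inv_le_one_of_one_le₀ hk)

/-- The zero-free hypothesis of `baezDuarte_moebiusSum_approx` ("`ζ(s)` does not vanish in the
half-plane `Re(s) > α`") is the tree's `QuasiRiemannHypothesis α` (no zeros with `α < re s < 1`,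
`Literature/…/GeneralizedRH.lean`), the closed half-plane `re s ≥ 1` being zero-free
unconditionally (Mathlib `riemannZeta_ne_zero_of_one_le_re`, which also covers Mathlib's finite
junk value `ζ(1)`). Under RH take `α = 1/2` via `quasiRiemannHypothesis_one_half_iff_holds`.
[folklore] -/
theorem forall_riemannZeta_ne_zero_iff_quasiRiemannHypothesis (α : ℝ) :
    (∀ s : ℂ, α < s.re → riemannZeta s ≠ 0) ↔ QuasiRiemannHypothesis α := by
  refine ⟨fun h s hs hα _ ↦ h s hα hs, fun h s hα hs ↦ ?_⟩
  by_cases h1 : s.re < 1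
  · exact h s hs hα h1
  · exact riemannZeta_ne_zero_of_one_le_re (not_lt.1 h1) hs

/-- **RH ⇒ `ζ(s) = O(t^ε)` on every line `σ > 1/2`** NAMED FACT (Littlewood; Titchmarsh §14.2:
"on the Riemann hypothesis", Thm. 14.2 `log ζ(s) = O((log t)^{2-2σ+ε})` uniformly for
`1/2 < σ₀ ≤ σ ≤ 1`, whence (14.2.5) "`ζ(s) = O(t^ε)` … for every `σ > 1/2`"). Recorded pointwise
in `σ`, as `t → +∞` (negative ordinates follow from `ζ(conj s) = conj ζ(s)`,
Mathlib `riemannZeta_conj`). At `σ = 1/2 + ε` and combined with `baezDuarte_zetaRatio_bound`, this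
is the "Lindelöf hypothesis applied to the abscissa `1/2 - ε`" input of Báez-Duarte's §2.2.
Users take `(h : zeta_isBigO_rpow_of_riemannHypothesis)`. [cite: Titchmarsh1986, §14.2 (14.2.5)] -/
def zeta_isBigO_rpow_of_riemannHypothesis : Prop :=
  RiemannHypothesis → ∀ σ ε : ℝ, 1 / 2 < σ → 0 < ε →
    (fun t : ℝ ↦ riemannZeta (σ + t * I)) =O[atTop] fun t : ℝ ↦ t ^ ε

/-- **RH ⇒ `1/ζ(s) = O(t^ε)` on every line `σ > 1/2`** NAMED FACT (Littlewood; Titchmarsh §14.2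
(14.2.6), same derivation as (14.2.5) from `-ε log t < log|ζ(s)| < ε log t`, `t > t₀(ε)`).
Recorded pointwise in `σ`, as `t → +∞`. Users take
`(h : zeta_inv_isBigO_rpow_of_riemannHypothesis)`. [cite: Titchmarsh1986, §14.2 (14.2.6)] -/
def zeta_inv_isBigO_rpow_of_riemannHypothesis : Prop :=
  RiemannHypothesis → ∀ σ ε : ℝ, 1 / 2 < σ → 0 < ε →
    (fun t : ℝ ↦ (riemannZeta (σ + t * I))⁻¹) =O[atTop] fun t : ℝ ↦ t ^ ε

/-- **RH ⇒ Lindelöf hypothesis** NAMED FACT (Titchmarsh §14.2, immediately after (14.2.6): "In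
particular, the truth of the Lindelöf hypothesis follows from that of the Riemann hypothesis";
`LindelofHypothesis` is the tree's `ζ(1/2+it) = O(t^ε)`, `Literature/…/RHWave0.lean`). Users take
`(h : lindelofHypothesis_of_riemannHypothesis)`. [cite: Titchmarsh1986, §14.2] -/
def lindelofHypothesis_of_riemannHypothesis : Prop :=
  RiemannHypothesis → LindelofHypothesis

end Literature.NumberTheory.LFunctions

end
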